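import Summits.ResolutionOfSingularities.ResolutionOfSingularities.Theorems.FrobeniusLadderFRationalResolutionResidueSeparableCapture
import Mathlib.FieldTheory.IsSepClosed
import Mathlib.FieldTheory.Normal.Closure
import Mathlib.FieldTheory.Galois.Basic
import Mathlib.FieldTheory.IsAlgClosed.AlgebraicClosure
import Mathlib.RingTheory.TensorProduct.Maps
import Mathlib.RingTheory.Ideal.Quotient.Operations
import Mathlib.Algebra.Algebra.Subalgebra.Operations
import HarnessLib

/-!
# Crux `FrobeniusLadder.FRationalResolution` (stmt-ResolutionOfSingularities-15317), line `redirect`,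
# stub `stub_diagonalizableQuotientResolution` — the FIELD GLUE of the Galois route (isolated TWISTED points):
# a finite Galois extension `K'/K` of the GROUND field, a maximal ideal `𝔔'` of `B ⊗_K K'` over `𝔭`, and the
# residue embedding `ι : C/𝔔 → (B ⊗_K K')/𝔔'` compatible with `B`

This is item R1 of the Galois route (memo MEMO-15317-leafhand4-g7 §4): exactly the inputs `(K', 𝔔', ι, hι)` consumed by
`…GaloisUpstairsPiece.exists_piece_of_residue_embedding` (the upstairs piece) and
`…GaloisBaseChangeRegular.hloc_of_decomposition_stable_piece'` (the assembled scheme side). Setting: `B` a `K`-algebra,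
`𝔭 ⊆ B` maximal with `κ(𝔭) = B/𝔭` ALGEBRAIC over `K` (e.g. `B` of finite type over `K`), `C` a `B`-algebra, `𝔔 ⊆ C` maximal
over `𝔭` with `κ(𝔔)/κ(𝔭)` finite separable (e.g. `C` étale over `B`); the residue algebra `κ(𝔭) → κ(𝔔)` is any algebra
structure compatible with `B → C` (`halg`).

Construction: inside `Ω` = an algebraic closure of `κ(𝔔)` (algebraic, hence normal, over `K`), the separable capture
`…ResidueSeparableCapture.exists_finset_separable_mem_adjoin` gives finitely many `K`-separable `T ⊆ Ω` with
`κ(𝔔) ⊆ K(κ(𝔭) ∪ T)`; `K'` is the normal closure of `K(T)` inside the separable closure `K^{sep} ⊆ Ω` of `K` in `Ω` (Galois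
over `K` because `Ω/K` is normal), a finite Galois extension of `K` containing `T`; the `K`-algebra map
`Φ : B ⊗_K K' → Ω`, `b ⊗ a ↦ b̄ · a`, has as image a subalgebra of the algebraic extension `Ω/K`, hence a field, so
`𝔔' = ker Φ` is maximal, lies over `𝔭` (`κ(𝔭) → Ω` is injective), and its residue field `≅ im Φ ⊇ κ(𝔭) ∪ K' ⊇ κ(𝔔)`,
which is the embedding `ι`.

* **`exists_galois_residue_embedding`** — the statement above.

Honest label: generic field/tensor algebra toward ONE leaf stub (no stub, crux or summit closed); with it the Galois route
for the isolated twisted case of `stub_diagonalizableQuotientResolution` is complete in the tree modulo the decomposition-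
stability hypothesis `hD` alone. No definitions, no named facts, no sorry.
[cite: StacksProject, Tag 030M; Tag 09HD; Tag 0EXM]
-/

noncomputable section

-- single-problem summit: the doubled namespace component is forced
set_option linter.dupNamespace false

open scoped TensorProduct

namespace Summit.ResolutionOfSingularities.ResolutionOfSingularities.Theorems.FRationalResolution.GaloisResidueEmbedding

/-- **Field glue of the Galois route.** `K` a field, `B` a `K`-algebra, `𝔭 ⊆ B` maximal with `B/𝔭` algebraic over `K`;
`C` a `B`-algebra, `𝔔 ⊆ C` maximal, `B/𝔭 → C/𝔔` an algebra structure compatible with `B → C` (`halg`), finite and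
separable. Then there are a finite Galois extension `K'/K`, a maximal ideal `𝔔'` of `B ⊗_K K'` lying over `𝔭`, and a
ring homomorphism `ι : C/𝔔 → (B ⊗_K K')/𝔔'` such that `ι(c̄) = \overline{b ⊗ 1}` whenever `c` is the image of `b ∈ B`.
[cite: StacksProject, Tag 030M; Tag 09HD; Tag 0EXM] -/
theorem exists_galois_residue_embedding (K : Type) [Field K] {B C : Type} [CommRing B] [CommRing C]
    [Algebra K B] [Algebra B C]
    (𝔭 : Ideal B) [𝔭.IsMaximal] (𝔔 : Ideal C) [𝔔.IsMaximal]
    [Algebra (B ⧸ 𝔭) (C ⧸ 𝔔)]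
    (halg : ∀ b : B, algebraMap (B ⧸ 𝔭) (C ⧸ 𝔔) (Ideal.Quotient.mk 𝔭 b) = Ideal.Quotient.mk 𝔔 (algebraMap B C b))
    [Algebra.IsAlgebraic K (B ⧸ 𝔭)] [Module.Finite (B ⧸ 𝔭) (C ⧸ 𝔔)] [Algebra.IsSeparable (B ⧸ 𝔭) (C ⧸ 𝔔)] :
    ∃ (K' : Type) (_ : Field K') (_ : Algebra K K'), FiniteDimensional K K' ∧ IsGalois K K' ∧
      ∃ (𝔔' : Ideal (B ⊗[K] K')), 𝔔'.IsMaximal ∧ 𝔔'.comap (algebraMap B (B ⊗[K] K')) = 𝔭 ∧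
        ∃ ι : C ⧸ 𝔔 →+* (B ⊗[K] K') ⧸ 𝔔',
          ∀ b : B, ι (Ideal.Quotient.mk 𝔔 (algebraMap B C b)) =
            Ideal.Quotient.mk 𝔔' (algebraMap B (B ⊗[K] K') b) := by
  classical
  letI : Field (B ⧸ 𝔭) := Ideal.Quotient.field 𝔭
  letI : Field (C ⧸ 𝔔) := Ideal.Quotient.field 𝔔
  -- the residue fields `κ(𝔭) → κ(𝔔)` as a tower over `K`
  letI : Algebra K (C ⧸ 𝔔) := ((algebraMap (B ⧸ 𝔭) (C ⧸ 𝔔)).comp (algebraMap K (B ⧸ 𝔭))).toAlgebra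
  haveI : IsScalarTower K (B ⧸ 𝔭) (C ⧸ 𝔔) := IsScalarTower.of_algebraMap_eq (fun _ => rfl)
  haveI : Algebra.IsAlgebraic (B ⧸ 𝔭) (C ⧸ 𝔔) := Algebra.IsAlgebraic.of_finite (B ⧸ 𝔭) (C ⧸ 𝔔)
  haveI : Algebra.IsAlgebraic K (C ⧸ 𝔔) := Algebra.IsAlgebraic.trans K (B ⧸ 𝔭) (C ⧸ 𝔔)
  -- an algebraic closure `Ω` of `κ(𝔔)`: algebraic, hence normal, over `K`
  let Ω : Type := AlgebraicClosure (C ⧸ 𝔔)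
  haveI : IsScalarTower K (B ⧸ 𝔭) Ω := inferInstance
  haveI : IsScalarTower K (C ⧸ 𝔔) Ω := inferInstance
  haveI : IsScalarTower (B ⧸ 𝔭) (C ⧸ 𝔔) Ω := inferInstance
  haveI : IsAlgClosure K Ω := inferInstance
  haveI : Algebra.IsAlgebraic K Ω := IsAlgClosure.isAlgebraic
  haveI : Normal K Ω := inferInstance
  -- separable capture: `κ(𝔔) ⊆ K(κ(𝔭) ∪ T)` with `T` finite, `K`-separable, `K(T)/K` finite
  obtain ⟨T, hTsep, hcap, hTfin, _⟩ :=
    ResidueSeparableCapture.exists_finset_separable_mem_adjoin K (B ⧸ 𝔭) (C ⧸ 𝔔) Ω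
  -- the finite Galois extension: normal closure of `K(T)` inside the separable closure of `K` in `Ω`
  -- (packaged as an opaque type `K'` with an embedding `jK' : K' → Ω` whose image contains `T`)
  obtain ⟨K', _instField, _instAlg, _instFD, _instGal, jK', hTK'⟩ :
      ∃ (K' : Type) (_ : Field K') (_ : Algebra K K'), FiniteDimensional K K' ∧ IsGalois K K' ∧
        ∃ j : K' →ₐ[K] Ω, ∀ t ∈ T, ∃ a : K', j a = t := by
    let F : IntermediateField K Ω := separableClosure K Ω
    haveI : IsGalois K F := separableClosure.isGalois K Ω
    let E : IntermediateField K Ω := IntermediateField.adjoin K (T : Set Ω)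
    haveI : FiniteDimensional K E := hTfin
    have hEF : E ≤ F := by
      refine IntermediateField.adjoin_le_iff.mpr fun t ht => ?_
      exact (mem_separableClosure_iff).mpr (hTsep t ht)
    let N : IntermediateField K F := IntermediateField.normalClosure K E F
    haveI : IsGalois K N := IsGalois.normalClosure K E F
    haveI : FiniteDimensional K N := normalClosure.is_finiteDimensional K E F
    refine ⟨N, inferInstance, inferInstance, inferInstance, inferInstance, F.val.comp N.val, fun t ht => ?_⟩
    have htE : t ∈ E := IntermediateField.subset_adjoin K (T : Set Ω) ht
    have hmem : IntermediateField.inclusion hEF ⟨t, htE⟩ ∈ N :=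
      (IntermediateField.inclusion hEF).fieldRange_le_normalClosure ⟨⟨t, htE⟩, rfl⟩
    exact ⟨⟨IntermediateField.inclusion hEF ⟨t, htE⟩, hmem⟩, rfl⟩
  -- the `K`-algebra map `Φ : B ⊗_K K' → Ω`, `b ⊗ a ↦ b̄ · a`
  let e₁ : (B ⧸ 𝔭) →ₐ[K] Ω := IsScalarTower.toAlgHom K (B ⧸ 𝔭) Ω
  let Ψ : (B ⧸ 𝔭) ⊗[K] K' →ₐ[K] Ω := Algebra.TensorProduct.productMap e₁ jK'
  let q : B ⊗[K] K' →ₐ[K] (B ⧸ 𝔭) ⊗[K] K' :=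
    Algebra.TensorProduct.map (Ideal.Quotient.mkₐ K 𝔭) (AlgHom.id K K')
  let Φ : B ⊗[K] K' →ₐ[K] Ω := Ψ.comp q
  have hΦ : ∀ (b : B) (a : K'), Φ (b ⊗ₜ a) = algebraMap (B ⧸ 𝔭) Ω (Ideal.Quotient.mk 𝔭 b) * jK' a := by
    intro b a
    simp only [Φ, Ψ, q, AlgHom.comp_apply, Algebra.TensorProduct.map_tmul, AlgHom.id_apply,
      Ideal.Quotient.mkₐ_eq_mk, Algebra.TensorProduct.productMap_apply_tmul]
    rfl
  -- its image is a field (a subalgebra of the algebraic extension `Ω/K`)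
  have hfield : IsField Φ.range := Subalgebra.isField_of_algebraic Φ.range
  -- the residue field of `𝔔' = ker Φ` is `im Φ ⊇ κ(𝔭) ∪ K' ⊇ κ(𝔔)`
  have hrange : ∀ x : C ⧸ 𝔔, algebraMap (C ⧸ 𝔔) Ω x ∈ Φ.range := by
    intro x
    let S : IntermediateField K Ω := Φ.range.toIntermediateField' hfield
    have hle : IntermediateField.adjoin K (Set.range (algebraMap (B ⧸ 𝔭) Ω) ∪ (T : Set Ω)) ≤ S := by
      refine IntermediateField.adjoin_le_iff.mpr ?_
      rintro y (⟨z, rfl⟩ | hy)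
      · obtain ⟨b, rfl⟩ := Ideal.Quotient.mk_surjective z
        refine ⟨b ⊗ₜ (1 : K'), ?_⟩
        change Φ (b ⊗ₜ 1) = _
        rw [hΦ, map_one, mul_one]
      · obtain ⟨a, ha⟩ := hTK' y hy
        refine ⟨(1 : B) ⊗ₜ a, ?_⟩
        change Φ (1 ⊗ₜ a) = _
        rw [hΦ, map_one, map_one, one_mul, ha]
    exact hle (hcap x)
  let g : (C ⧸ 𝔔) →ₐ[K] Φ.range := (IsScalarTower.toAlgHom K (C ⧸ 𝔔) Ω).codRestrict Φ.range hrange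
  -- the first isomorphism theorem `(B ⊗_K K')/ker Φ ≅ im Φ`; `ker Φ` is maximal since `im Φ` is a field
  set Q : Ideal (B ⊗[K] K') := RingHom.ker Φ.rangeRestrict with hQ
  have hker : Q = RingHom.ker Φ := AlgHom.ker_rangeRestrict Φ
  let ε : ((B ⊗[K] K') ⧸ Q) ≃ₐ[K] Φ.range :=
    Ideal.quotientKerAlgEquivOfSurjective (AlgHom.rangeRestrict_surjective Φ)
  have hmax : Q.IsMaximal := Ideal.Quotient.maximal_of_isField Q (MulEquiv.isField hfield ε.toMulEquiv)
  refine ⟨K', inferInstance, inferInstance, inferInstance, inferInstance, Q, hmax, ?_,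
    (ε.symm : Φ.range →ₐ[K] _).toRingHom.comp g.toRingHom, fun b => ?_⟩
  · -- over `𝔭`: `Φ(b ⊗ 1) = b̄` and `κ(𝔭) → Ω` is injective
    rw [hker]
    ext b
    rw [Ideal.mem_comap, RingHom.mem_ker, Algebra.TensorProduct.algebraMap_apply, Algebra.algebraMap_self,
      RingHom.id_apply, ← Ideal.Quotient.eq_zero_iff_mem]
    change Φ (b ⊗ₜ 1) = 0 ↔ _
    rw [hΦ, map_one, mul_one, map_eq_zero_iff _ (algebraMap (B ⧸ 𝔭) Ω).injective]
  · -- compatibility with `B`: both sides map to `b̄ ∈ Ω` under the injection `ε`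
    apply ε.injective
    change ε (ε.symm (g (Ideal.Quotient.mk 𝔔 (algebraMap B C b)))) = _
    rw [AlgEquiv.apply_symm_apply]
    apply Subtype.ext
    have h1 : ((g (Ideal.Quotient.mk 𝔔 (algebraMap B C b)) : Φ.range) : Ω) =
        algebraMap (C ⧸ 𝔔) Ω (Ideal.Quotient.mk 𝔔 (algebraMap B C b)) := rfl
    have h2 : ((ε (Ideal.Quotient.mk Q (algebraMap B (B ⊗[K] K') b)) : Φ.range) : Ω) =
        Φ (algebraMap B (B ⊗[K] K') b) := by
      have h := Ideal.quotientKerAlgEquivOfSurjective_mk (AlgHom.rangeRestrict_surjective Φ)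
        (algebraMap B (B ⊗[K] K') b)
      exact congrArg Subtype.val h
    rw [h1, h2, ← halg, ← IsScalarTower.algebraMap_apply, Algebra.TensorProduct.algebraMap_apply,
      Algebra.algebraMap_self, RingHom.id_apply, hΦ, map_one, mul_one]

end Summit.ResolutionOfSingularities.ResolutionOfSingularities.Theorems.FRationalResolution.GaloisResidueEmbedding

end
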